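import Summits.QuantumFields.GaugeBoot.ZdLoopClasses
import Summits.QuantumFields.GaugeBoot.ZdLoopEquationSU2
import Summits.QuantumFields.GaugeBoot.PairLoopClasses
import Summits.QuantumFields.GaugeBoot.GLYZc1D3TraceRowsA
import HarnessLib

/-!
# Positioned pairs of loops on `ℤ^d`: the pair expectation `∫ W_x(A)·W_y(B) dμ` of an invariant state and its symmetry class (gauge-boot, Class-B rows, supplement)

HONEST FRAMING (cell `pub-gaugeboot`, page 1 of every file): the venture produces certified bounds
on lattice expectations at stated coupling, gauge group, dimension and torus size; NOT a mass gap,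
NOT a continuum limit, NOT a string tension; NOT Yang–Mills-summit-bearing (barriers
`FixedCouplingUltralocality`, `PerturbativeInvisibility`).

`PairLoopClasses.lean` identifies PRODUCTS of two loop variables read from two integer base points along
pair scripts (`PMove`: joint translation / axis permutation / reflection of axis `0`, per-component
reversal / one-letter rotation / free reduction) on the torus — the engine behind the `SU(2)` TRACE rows
of `MMRowSU2.lean`. This file is the same for a measure `μ` on the infinite lattice `ℤ^d` that is
translation invariant and invariant under axis permutations and axis reflections (the invariance
axioms of `ClassBState`); base points ARE integer vectors, no cast:

* `pairExpZd ρ μ p q = ∫ W_{p.base}(p.word)·W_{q.base}(q.word) dμ`; `pairExpZd_comm`;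
* `pairExpZd_shift` / `_perm` / `_refl0` (measure symmetries, `ZdWordSymmetry.lean`), `pairExpZd_rev_left` /
  `_rot_left` / `_red_left` (pointwise, `ZdLoopClasses.lean`), `pairExpZd_apply`, **`pairExpZd_run`**,
  `pairExpZd_eq_of_run` — the scripts `PMove.run` / side conditions `PMove.closedAlong` of
  `PairLoopClasses.lean` verbatim;
* `SU(2)`: `two_mul_wordLoopZd_mul_su_two` (pointwise `2·W_x(C₁)·W_x(C₂) = W_x(C₁C₂) + W_x(C₁C₂⁻¹)`) and
  **`su2_rawTrace_zd`** (`2·∫ W_v(C₁) W_v(C₂) dμ = ∫ W_v(C₁C₂) dμ + ∫ W_v(C₁C₂⁻¹) dμ`, any finite `μ`).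

Everything is `[folklore]`.
-/

noncomputable section

open MeasureTheory
open scoped Matrix
open Literature.Probability.LatticeModels (Site)
open Literature.MathematicalPhysics.QuantumLattice (LGConfig ZdEdge configShift IsZdTranslationInvariant
  fundamentalRep fundamentalRep_apply)

namespace Summit.QuantumFields.GaugeBoot

variable {d N : ℕ} {G : Type*} [Group G]

/-! ### Pointwise -/

section Pointwise

omit [Group G] in
/-- A step moves its base point by its displacement, exactly on `ℤ^d`. [folklore] -/
theorem Step.applyZd_eq_add_disp (x : Site d) (s : Step d) : s.applyZd x = x + s.disp := by
  cases s <;> simp [Step.applyZd, Step.disp, sub_eq_add_neg]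

omit [Group G] in
/-- `permZ π b ∘ π = b`. [folklore] -/
theorem PLoop.permZ_comp (π : Equiv.Perm (Fin d)) (b : Fin d → ℤ) : (PLoop.permZ π b) ∘ π = b := by
  funext k; simp [PLoop.permZ]

omit [Group G] in
/-- The axis-`0` reflection of `ℤ^d` undoes `refl0Z`. [folklore] -/
theorem zdSiteReflect_zero_refl0Z [NeZero d] (b : Fin d → ℤ) : zdSiteReflect 0 (PLoop.refl0Z b) = b := by
  ext k
  by_cases hk : k = 0
  · subst hk; simp [zdSiteReflect, PLoop.refl0Z]
  · simp [zdSiteReflect, PLoop.refl0Z, hk]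

omit [Group G] in
/-- Permuting the letters back. [folklore] -/
theorem Word.map_permute_map_permute_symm (π : Equiv.Perm (Fin d)) (w : Word d) :
    (w.map (Step.permute π)).map (Step.permute π.symm) = w := by
  rw [List.map_map]
  conv_rhs => rw [← List.map_id w]
  exact List.map_congr_left fun s _ => by simp

omit [Group G] in
/-- Reflecting the letters back (axis `0`). [folklore] -/
theorem Word.map_reflect0_map_flipAt_zero [NeZero d] (w : Word d) :
    (w.map Step.reflect0).map (Step.flipAt 0) = w := by
  rw [Word.map_reflect0_eq, List.map_map]
  conv_rhs => rw [← List.map_id w]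
  refine List.map_congr_left fun s _ => ?_
  simp only [Function.comp_apply, Step.reflectAxis_eq_flipAt, id]
  cases s with
  | fwd μ => by_cases h : μ = 0 <;> simp [Step.flipAt, h]
  | bwd μ => by_cases h : μ = 0 <;> simp [Step.flipAt, h]

end Pointwise

/-! ### The pair expectation of a state and its invariances -/

section Expectation

variable [TopologicalSpace G] [IsTopologicalGroup G] [CompactSpace G] [MeasurableSpace G] [BorelSpace G]
  [SecondCountableTopology G] (ρ : G →* Matrix (Fin N) (Fin N) ℂ) (μW : Measure (LGConfig d G))

/-- **The pair expectation on `ℤ^d`**: `∫ W_{p.base}(p.word)·W_{q.base}(q.word) dμ` (G1's double trace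
`d(C₁,C₂)` for a state of the infinite lattice). [folklore] -/
def pairExpZd (p q : PLoop d) : ℝ :=
  ∫ U, wordLoopZd ρ p.base p.word U * wordLoopZd ρ q.base q.word U ∂μW

omit [TopologicalSpace G] [IsTopologicalGroup G] [CompactSpace G] [BorelSpace G] [SecondCountableTopology G] in
/-- `⟨W_p W_q⟩ = ⟨W_q W_p⟩`. [folklore] -/
theorem pairExpZd_comm (p q : PLoop d) : pairExpZd ρ μW p q = pairExpZd ρ μW q p := by
  unfold pairExpZd
  simp_rw [mul_comm]

variable {μW}

omit [CompactSpace G] in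
/-- **Joint translation invariance.** [folklore] -/
theorem pairExpZd_shift (hρ : Continuous ρ) (hT : IsZdTranslationInvariant μW) (t : Fin d → ℤ) (p q : PLoop d) :
    pairExpZd ρ μW (p.shift t) (q.shift t) = pairExpZd ρ μW p q := by
  unfold pairExpZd PLoop.shift
  have h := integral_comp_eq_of_measurePreserving_real (measurePreserving_configShift hT t)
    (fun U => wordLoopZd ρ (p.base + t) p.word U * wordLoopZd ρ (q.base + t) q.word U)
    ((continuous_wordLoopZd hρ _ _).mul (continuous_wordLoopZd hρ _ _))
  simp only [wordLoopZd_apply, wordHolonomyZd_configShift, add_sub_cancel_right] at h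
  simp only [wordLoopZd_apply]
  exact h.symm

omit [CompactSpace G] in
/-- **Joint axis-permutation invariance.** [folklore] -/
theorem pairExpZd_perm (hρ : Continuous ρ) {π : Equiv.Perm (Fin d)} (hP : MeasurePreserving (configPerm π) μW μW)
    (p q : PLoop d) : pairExpZd ρ μW (p.perm π) (q.perm π) = pairExpZd ρ μW p q := by
  unfold pairExpZd PLoop.perm
  have h := integral_comp_eq_of_measurePreserving_real hP
    (fun U => wordLoopZd ρ (PLoop.permZ π p.base) (p.word.map (Step.permute π)) U *
      wordLoopZd ρ (PLoop.permZ π q.base) (q.word.map (Step.permute π)) U)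
    ((continuous_wordLoopZd hρ _ _).mul (continuous_wordLoopZd hρ _ _))
  simp only [wordLoopZd_apply, wordHolonomyZd_configPerm, PLoop.permZ_comp,
    Word.map_permute_map_permute_symm] at h
  simp only [wordLoopZd_apply]
  exact h.symm

omit [CompactSpace G] in
/-- **Joint reflection invariance** (axis `0`). [folklore] -/
theorem pairExpZd_refl0 [NeZero d] (hρ : Continuous ρ) (hR : MeasurePreserving (configSiteReflect 0) μW μW)
    (p q : PLoop d) : pairExpZd ρ μW p.refl0 q.refl0 = pairExpZd ρ μW p q := by
  unfold pairExpZd PLoop.refl0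
  have h := integral_comp_eq_of_measurePreserving_real hR
    (fun U => wordLoopZd ρ (PLoop.refl0Z p.base) (p.word.map Step.reflect0) U *
      wordLoopZd ρ (PLoop.refl0Z q.base) (q.word.map Step.reflect0) U)
    ((continuous_wordLoopZd hρ _ _).mul (continuous_wordLoopZd hρ _ _))
  simp only [wordLoopZd_apply, wordHolonomyZd_configSiteReflect, zdSiteReflect_zero_refl0Z,
    Word.map_reflect0_map_flipAt_zero] at h
  simp only [wordLoopZd_apply]
  exact h.symm

omit [BorelSpace G] [SecondCountableTopology G] in
/-- **Reversal of a closed component** (pointwise). [folklore] -/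
theorem pairExpZd_rev_left (hρ : Continuous ρ) (p q : PLoop d) (hp : p.Closed) :
    pairExpZd ρ μW p.rev q = pairExpZd ρ μW p q := by
  unfold pairExpZd PLoop.rev
  simp only [wordLoopZd_reverse ρ hρ _ _ (endpointZd_eq_self_of_disp _ hp)]

omit [TopologicalSpace G] [IsTopologicalGroup G] [CompactSpace G] [BorelSpace G] [SecondCountableTopology G] in
/-- **Rotation of a closed component by one letter** (pointwise). [folklore] -/
theorem pairExpZd_rot_left (p q : PLoop d) (hp : p.Closed) : pairExpZd ρ μW p.rot q = pairExpZd ρ μW p q := by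
  unfold pairExpZd PLoop.rot
  rcases p with ⟨b, w⟩
  cases w with
  | nil => rfl
  | cons s w =>
    simp only
    rw [← Step.applyZd_eq_add_disp]
    simp only [← wordLoopZd_rotate ρ b s w (endpointZd_eq_self_of_disp _ hp)]

omit [TopologicalSpace G] [IsTopologicalGroup G] [CompactSpace G] [BorelSpace G] [SecondCountableTopology G] in
/-- **Free reduction of a component** (pointwise). [folklore] -/
theorem pairExpZd_red_left (p q : PLoop d) : pairExpZd ρ μW p.red q = pairExpZd ρ μW p q := by
  unfold pairExpZd PLoop.red
  simp only [wordLoopZd_freeReduce]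

variable [NeZero d]

/-- One admissible move preserves the pair expectation of an invariant state. [folklore] -/
theorem pairExpZd_apply (hρ : Continuous ρ) (hT : IsZdTranslationInvariant μW)
    (hP : ∀ σ : Equiv.Perm (Fin d), MeasurePreserving (configPerm σ) μW μW)
    (hR : MeasurePreserving (configSiteReflect 0) μW μW) (m : PMove d) (pq : PLoop d × PLoop d)
    (hm : m.ok pq) : pairExpZd ρ μW (m.apply pq).1 (m.apply pq).2 = pairExpZd ρ μW pq.1 pq.2 := by
  rcases pq with ⟨p, q⟩
  cases m with
  | shift t => exact pairExpZd_shift ρ hρ hT t p q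
  | perm π => exact pairExpZd_perm ρ hρ (hP π) p q
  | refl0 => exact pairExpZd_refl0 ρ hρ hR p q
  | revL => exact pairExpZd_rev_left ρ hρ p q hm
  | revR => rw [PMove.apply, pairExpZd_comm, pairExpZd_rev_left ρ hρ q p hm, pairExpZd_comm]
  | rotL => exact pairExpZd_rot_left ρ p q hm
  | rotR => rw [PMove.apply, pairExpZd_comm, pairExpZd_rot_left ρ q p hm, pairExpZd_comm]
  | redL => exact pairExpZd_red_left ρ p q
  | redR => rw [PMove.apply, pairExpZd_comm, pairExpZd_red_left ρ q p, pairExpZd_comm]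

/-- **Master identification lemma for positioned pairs on `ℤ^d`.** A pair script whose side conditions
hold along the run preserves `∫ W_p·W_q dμ` for every translation-, permutation- and reflection-invariant
state. [folklore] -/
theorem pairExpZd_run (hρ : Continuous ρ) (hT : IsZdTranslationInvariant μW)
    (hP : ∀ σ : Equiv.Perm (Fin d), MeasurePreserving (configPerm σ) μW μW)
    (hR : MeasurePreserving (configSiteReflect 0) μW μW) :
    ∀ (ms : List (PMove d)) (pq : PLoop d × PLoop d), PMove.closedAlong ms pq →
      pairExpZd ρ μW (PMove.run ms pq).1 (PMove.run ms pq).2 = pairExpZd ρ μW pq.1 pq.2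
  | [], _, _ => rfl
  | m :: ms, pq, h => by
    rw [PMove.run, pairExpZd_run hρ hT hP hR ms (m.apply pq) h.2, pairExpZd_apply ρ hρ hT hP hR m pq h.1]

/-- **Two positioned pairs joined by a checked script have the same expectation** on an invariant
state. [folklore] -/
theorem pairExpZd_eq_of_run (hρ : Continuous ρ) (hT : IsZdTranslationInvariant μW)
    (hP : ∀ σ : Equiv.Perm (Fin d), MeasurePreserving (configPerm σ) μW μW)
    (hR : MeasurePreserving (configSiteReflect 0) μW μW) (ms : List (PMove d)) (p q p' q' : PLoop d)
    (h : PMove.closedAlong ms (p, q) ∧ PMove.run ms (p, q) = (p', q')) :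
    pairExpZd ρ μW p q = pairExpZd ρ μW p' q' := by
  have := pairExpZd_run ρ hρ hT hP hR ms (p, q) h.1
  rw [h.2] at this
  exact this.symm

end Expectation

/-! ### `SU(2)`: a product of two loops is a sum of two loops -/

section SU2

/-- **`SU(2)`, pointwise on `ℤ^d`**: `2·W_x(C₁)·W_x(C₂) = W_x(C₁·C₂) + W_x(C₁·C₂⁻¹)` for closed `C₁, C₂`.
[folklore] -/
theorem two_mul_wordLoopZd_mul_su_two (x : Site d) (C₁ C₂ : Word d) (h₁ : Word.disp C₁ = 0)
    (h₂ : Word.disp C₂ = 0) (U : LGConfig d (SU 2)) :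
    2 * (wordLoopZd (suRep 2) x C₁ U * wordLoopZd (suRep 2) x C₂ U) =
      wordLoopZd (suRep 2) x (C₁ ++ C₂) U + wordLoopZd (suRep 2) x (C₁ ++ Word.reverse C₂) U := by
  have hw : Word.endpointZd x (C₁ ++ C₂) = x :=
    endpointZd_eq_self_of_disp x (by rw [Word.disp_append, h₁, h₂, add_zero])
  have hk : Word.endpointZd x ((C₁ ++ C₂).take C₁.length) = x := by
    rw [List.take_left]
    exact endpointZd_eq_self_of_disp x h₁
  have ht := trace_split_su_two_zd x (C₁ ++ C₂) C₁.length hw hk U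
  rw [List.take_left, List.drop_left] at ht
  simp only [wordLoopZd_apply]
  rw [trace_su_two_eq_ofReal (wordHolonomyZd U x C₁), trace_su_two_eq_ofReal (wordHolonomyZd U x C₂),
    trace_su_two_eq_ofReal (wordHolonomyZd U x (C₁ ++ C₂)),
    trace_su_two_eq_ofReal (wordHolonomyZd U x (C₁ ++ Word.reverse C₂))] at ht
  have ht' := congrArg Complex.re ht
  simp only [Complex.ofReal_re, Complex.add_re, Complex.mul_re, Complex.ofReal_im, mul_zero, sub_zero] at ht'
  simp only [fundamentalRep_apply] at ht' ⊢
  push_cast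
  linear_combination (1 / 2 : ℝ) * ht'

/-- **`SU(2)` raw trace relation for a state of `ℤ^d`**: for closed `C₁, C₂` read from the integer point
`v` and every finite measure `μ`,
`2·∫ W_v(C₁)·W_v(C₂) dμ = ∫ W_v(C₁·C₂) dμ + ∫ W_v(C₁·C₂⁻¹) dμ`. [folklore] -/
theorem su2_rawTrace_zd (μ : Measure (LGConfig d (SU 2))) [IsFiniteMeasure μ] (v : Fin d → ℤ)
    (C₁ C₂ : Word d) (h₁ : Word.disp C₁ = 0) (h₂ : Word.disp C₂ = 0) :
    2 * pairExpZd (suRep 2) μ ⟨v, C₁⟩ ⟨v, C₂⟩ =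
      (∫ U, wordLoopZd (suRep 2) v (C₁ ++ C₂) U ∂μ) + ∫ U, wordLoopZd (suRep 2) v (C₁ ++ Word.reverse C₂) U ∂μ := by
  unfold pairExpZd
  rw [← integral_add (integrable_wordLoopZd (suRep 2) (continuous_suRep 2) μ _ _)
    (integrable_wordLoopZd (suRep 2) (continuous_suRep 2) μ _ _), ← integral_const_mul]
  exact integral_congr_ae (ae_of_all _ fun U => two_mul_wordLoopZd_mul_su_two v C₁ C₂ h₁ h₂ U)

end SU2

end Summit.QuantumFields.GaugeBoot

end
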